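import Literature.Algebra.Homology.RankTwoLatticeCohomologyCharacters
import Mathlib.RepresentationTheory.Homological.GroupCohomology.LongExactSequence
import HarnessLib

/-!
# Scalar-type filtrations on group cohomology from stable filtrations of the coefficients

Topic `Algebra/Homology`; namespace `Literature.Algebra.Homology`.  Mathlib + `ScalarFiltration`,
`RankTwoLatticeCohomologyCharacters` (the vocabulary `trivRep`, `pairScalar`, `pairMapₛ`); definitions
with bodies and theorems.

Let `A` be a representation of `G` over a field `k`, `c : X → (G →* G)` a family of endomorphisms
and `φ x : A ∘ c x ⟶ A` pair maps, giving operators `Φ_x = Hⁿ(c x, φ x)` on `Hⁿ(G, A)`.  For a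
`G`- and `φ`-stable submodule `W ≤ A` write `Φ_x^W` for the operators on `Hⁿ(G, W)`.  We prove the
dévissage by which torus eigencharacters on the cohomology of a unipotent arithmetic group with
algebraic coefficients are computed [Harder1987, §2]:

* `scalarFiltered_sub_bot` — `Hⁿ(G, 0)` is (trivially) scalar-filtered;
* `scalarFiltered_sub_sup_span` — **one-dimensional extension step**: if `Hⁿ(G, W)` is
  scalar-filtered with characters `S` for all `n`, and `v ∈ A` is `G`-invariant and a
  `φ`-eigenvector with character `χ` *modulo `W`*, and the scaled pair maps `Hⁿ(c x, χ x)` on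
  `Hⁿ(G, k)` are scalar-filtered with characters in `S`, then `Hⁿ(G, W + k v)` is scalar-filtered
  with characters `S` (long exact sequence of `0 → W → W + kv → k_χ → 0` and
  `ScalarFiltered.of_exact`);
* `scalarFiltered_of_sub_top` — from `W = ⊤` back to `A`.

## References

* G. Harder, *Eisenstein cohomology of arithmetic groups. The case GL₂*, Invent. Math. 89 (1987), §2.
  [Harder1987]
* K. S. Brown, *Cohomology of Groups*, GTM 87 (1982), III §6. [Brown1982CohomologyGroups]
-/

noncomputable section

open CategoryTheory CategoryTheory.Limits groupCohomology Literature.LinearAlgebra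

universe u

namespace Literature.Algebra.Homology

variable {k G : Type u} [Field k] [Group G] (A : Rep.{u} k G)

/-- `Hⁿ(f, φ)` depends only on `f` and the underlying function of `φ` (as
`CoinducedConjugation.map_congr'`). [folklore] -/
private theorem map_congr'' {H : Type u} [Group H] {X : Rep k H} {Y : Rep k G} {f₁ f₂ : G →* H} (h : f₁ = f₂)
    (φ₁ : Rep.res f₁ X ⟶ Y) (φ₂ : Rep.res f₂ X ⟶ Y) (hφ : ∀ x : X, φ₁.hom x = φ₂.hom x) (n : ℕ) :
    groupCohomology.map f₁ φ₁ n = groupCohomology.map f₂ φ₂ n := by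
  subst h
  have : φ₁ = φ₂ := Rep.hom_ext (Representation.IntertwiningMap.ext (LinearMap.ext hφ))
  rw [this]

/-! ### Stable submodules, their inclusions and quotients -/

/-- A `G`-stable submodule as a representation (Mathlib `Rep.subrepresentation`). [folklore] -/
abbrev subRep (W : Submodule k A) (hW : ∀ g, W ≤ W.comap (A.ρ g)) : Rep k G :=
  Rep.subrepresentation A W hW

variable {A} in
/-- The inclusion `W ⟶ W'` of stable submodules `W ≤ W'`. [folklore] -/
def subInclusion {W W' : Submodule k A} (hW : ∀ g, W ≤ W.comap (A.ρ g))
    (hW' : ∀ g, W' ≤ W'.comap (A.ρ g)) (hle : W ≤ W') : subRep A W hW ⟶ subRep A W' hW' :=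
  Rep.ofHom (LinearMap.intertwiningMap_of_isIntertwiningMap _ _ (Submodule.inclusion hle) fun _ _ => rfl)

/-- Unfolding `subInclusion`. [folklore] -/
@[simp]
theorem subInclusion_hom_apply_coe {W W' : Submodule k A} (hW : ∀ g, W ≤ W.comap (A.ρ g))
    (hW' : ∀ g, W' ≤ W'.comap (A.ρ g)) (hle : W ≤ W') (w : W) :
    ((subInclusion hW hW' hle).hom w : A) = w := rfl

/-- `W` as a submodule of `W'` (`W ≤ W'`). [folklore] -/
abbrev subIn (W W' : Submodule k A) : Submodule k W' := W.comap W'.subtype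

/-- `W ≤ W'` is stable in `W'`. [folklore] -/
theorem subIn_stable {W W' : Submodule k A} (hW : ∀ g, W ≤ W.comap (A.ρ g))
    (hW' : ∀ g, W' ≤ W'.comap (A.ρ g)) (g : G) :
    subIn A W W' ≤ (subIn A W W').comap ((subRep A W' hW').ρ g) := fun _ hw => hW g hw

/-- The quotient `W' / W` of stable submodules as a representation. [folklore] -/
abbrev subQuot {W W' : Submodule k A} (hW : ∀ g, W ≤ W.comap (A.ρ g))
    (hW' : ∀ g, W' ≤ W'.comap (A.ρ g)) : Rep k G :=
  Rep.quotient (subRep A W' hW') (subIn A W W') (subIn_stable A hW hW')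

/-- The projection `W' ⟶ W' / W`. [folklore] -/
abbrev subMkQ {W W' : Submodule k A} (hW : ∀ g, W ≤ W.comap (A.ρ g))
    (hW' : ∀ g, W' ≤ W'.comap (A.ρ g)) : subRep A W' hW' ⟶ subQuot A hW hW' :=
  Rep.mkQ (subRep A W' hW') (subIn A W W') (subIn_stable A hW hW')

/-- **The short exact sequence `0 → W → W' → W'/W → 0`** of representations. [folklore] -/
def subQuotComplex {W W' : Submodule k A} (hW : ∀ g, W ≤ W.comap (A.ρ g))
    (hW' : ∀ g, W' ≤ W'.comap (A.ρ g)) (hle : W ≤ W') : ShortComplex (Rep k G) :=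
  ShortComplex.mk (subInclusion hW hW' hle) (subMkQ A hW hW')
    (Rep.hom_ext (Representation.IntertwiningMap.ext (LinearMap.ext fun w =>
      (Submodule.Quotient.mk_eq_zero _).2 (show ((subInclusion hW hW' hle).hom w : A) ∈ W from w.2))))

/-- Components of `subQuotComplex`. [folklore] -/
@[simp]
theorem subQuotComplex_f {W W' : Submodule k A} (hW : ∀ g, W ≤ W.comap (A.ρ g))
    (hW' : ∀ g, W' ≤ W'.comap (A.ρ g)) (hle : W ≤ W') :
    (subQuotComplex A hW hW' hle).f = subInclusion hW hW' hle := rfl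

/-- Components of `subQuotComplex`. [folklore] -/
@[simp]
theorem subQuotComplex_g {W W' : Submodule k A} (hW : ∀ g, W ≤ W.comap (A.ρ g))
    (hW' : ∀ g, W' ≤ W'.comap (A.ρ g)) (hle : W ≤ W') :
    (subQuotComplex A hW hW' hle).g = subMkQ A hW hW' := rfl

/-- Mathlib's `groupCohomology.functor` on morphisms. [folklore] -/
theorem functor_map_eq {B C : Rep.{u} k G} (ψ : B ⟶ C) (n : ℕ) :
    (groupCohomology.functor k G n).map ψ = groupCohomology.map (MonoidHom.id G) ψ n := rfl

/-- `0 → W → W' → W'/W → 0` is short exact. [folklore] -/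
theorem subQuotComplex_shortExact {W W' : Submodule k A} (hW : ∀ g, W ≤ W.comap (A.ρ g))
    (hW' : ∀ g, W' ≤ W'.comap (A.ρ g)) (hle : W ≤ W') : (subQuotComplex A hW hW' hle).ShortExact where
  exact := (forget₂ (Rep.{u} k G) (ModuleCat.{u} k)).reflects_exact_of_faithful _ <|
    (ShortComplex.moduleCat_exact_iff _).2 fun (w' : W') hw' => by
      change (subIn A W W').mkQ w' = 0 at hw'
      rw [Submodule.mkQ_apply, Submodule.Quotient.mk_eq_zero] at hw'
      exact ⟨⟨(w' : A), hw'⟩, Subtype.ext rfl⟩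
  mono_f := (Rep.mono_iff_injective _).2 fun a b h =>
    Subtype.ext (congrArg (fun w : W' => (w : A)) h :)
  epi_g := (Rep.epi_iff_surjective _).2 (Submodule.mkQ_surjective _)

/-! ### Pair maps on stable submodules and quotients -/

variable {A}
variable (c : G →* G) (φ : Rep.res c A ⟶ A)

/-- The pair map restricted to a `φ`-stable, `G`-stable submodule. [folklore] -/
def pairSub (W : Submodule k A) (hW : ∀ g, W ≤ W.comap (A.ρ g)) (hφ : ∀ w ∈ W, φ.hom w ∈ W) :
    Rep.res c (subRep A W hW) ⟶ subRep A W hW :=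
  Rep.ofHom (LinearMap.intertwiningMap_of_isIntertwiningMap _ _
    (φ.hom.toLinearMap.restrict (p := W) (q := W) hφ) fun g w => Subtype.ext (Rep.hom_comm_apply φ g (w : A)))

/-- Unfolding `pairSub`. [folklore] -/
@[simp]
theorem pairSub_hom_apply_coe (W : Submodule k A) (hW : ∀ g, W ≤ W.comap (A.ρ g))
    (hφ : ∀ w ∈ W, φ.hom w ∈ W) (w : W) : ((pairSub c φ W hW hφ).hom w : A) = φ.hom w := rfl

/-- The pair map induced on `W'/W` (`W ≤ W'` both stable). [folklore] -/
def pairSubQuot {W W' : Submodule k A} (hW : ∀ g, W ≤ W.comap (A.ρ g))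
    (hW' : ∀ g, W' ≤ W'.comap (A.ρ g)) (hφ : ∀ w ∈ W, φ.hom w ∈ W) (hφ' : ∀ w ∈ W', φ.hom w ∈ W') :
    Rep.res c (subQuot A hW hW') ⟶ subQuot A hW hW' :=
  Rep.ofHom (LinearMap.intertwiningMap_of_isIntertwiningMap _ _
    ((subIn A W W').mapQ (subIn A W W') (φ.hom.toLinearMap.restrict (p := W') (q := W') hφ')
      fun w hw => hφ _ hw) fun g q => by
      obtain ⟨w, rfl⟩ := Submodule.mkQ_surjective _ q
      exact congrArg (subIn A W W').mkQ
        (Subtype.ext (Rep.hom_comm_apply φ g (w : A)) :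
          (φ.hom.toLinearMap.restrict (p := W') (q := W') hφ') ((subRep A W' hW').ρ (c g) w) =
            (subRep A W' hW').ρ g ((φ.hom.toLinearMap.restrict (p := W') (q := W') hφ') w)))

/-- Unfolding `pairSubQuot`. [folklore] -/
theorem pairSubQuot_hom_apply_mk {W W' : Submodule k A} (hW : ∀ g, W ≤ W.comap (A.ρ g))
    (hW' : ∀ g, W' ≤ W'.comap (A.ρ g)) (hφ : ∀ w ∈ W, φ.hom w ∈ W) (hφ' : ∀ w ∈ W', φ.hom w ∈ W')
    (w : W') :
    (pairSubQuot c φ hW hW' hφ hφ').hom ((subIn A W W').mkQ w) =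
      (subIn A W W').mkQ ⟨φ.hom w, hφ' _ w.2⟩ := rfl

/-- The pair operators `Φ_x^W = Hⁿ(c x, φ x|_W)` on `Hⁿ(G, W)`. [folklore] -/
abbrev pairSubEnd {X : Type*} (c : X → (G →* G)) (φ : ∀ x, Rep.res (c x) A ⟶ A)
    (W : Submodule k A) (hW : ∀ g, W ≤ W.comap (A.ρ g)) (hφ : ∀ x, ∀ w ∈ W, (φ x).hom w ∈ W)
    (n : ℕ) (x : X) : Module.End k (groupCohomology (subRep A W hW) n) :=
  (groupCohomology.map (c x) (pairSub (c x) (φ x) W hW (hφ x)) n).hom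

/-! ### Naturality of the pair maps on cohomology -/

/-- `Hⁿ(c, φ|_W) ≫ Hⁿ(W ↪ W') = Hⁿ(W ↪ W') ≫ Hⁿ(c, φ|_{W'})`. [folklore] -/
theorem map_pairSub_comp_inclusion {W W' : Submodule k A} (hW : ∀ g, W ≤ W.comap (A.ρ g))
    (hW' : ∀ g, W' ≤ W'.comap (A.ρ g)) (hle : W ≤ W') (hφ : ∀ w ∈ W, φ.hom w ∈ W)
    (hφ' : ∀ w ∈ W', φ.hom w ∈ W') (n : ℕ) :
    groupCohomology.map c (pairSub c φ W hW hφ) n ≫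
        groupCohomology.map (MonoidHom.id G) (subInclusion hW hW' hle) n =
      groupCohomology.map (MonoidHom.id G) (subInclusion hW hW' hle) n ≫
        groupCohomology.map c (pairSub c φ W' hW' hφ') n := by
  rw [← groupCohomology.map_comp, ← groupCohomology.map_comp]
  exact map_congr'' rfl _ _ (fun _ => rfl) n

/-- `Hⁿ(c, φ|_{W'}) ≫ Hⁿ(W' ↠ W'/W) = Hⁿ(W' ↠ W'/W) ≫ Hⁿ(c, φ̄)`. [folklore] -/
theorem map_pairSub_comp_mkQ {W W' : Submodule k A} (hW : ∀ g, W ≤ W.comap (A.ρ g))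
    (hW' : ∀ g, W' ≤ W'.comap (A.ρ g)) (hφ : ∀ w ∈ W, φ.hom w ∈ W)
    (hφ' : ∀ w ∈ W', φ.hom w ∈ W') (n : ℕ) :
    groupCohomology.map c (pairSub c φ W' hW' hφ') n ≫
        groupCohomology.map (MonoidHom.id G) (subMkQ A hW hW') n =
      groupCohomology.map (MonoidHom.id G) (subMkQ A hW hW') n ≫
        groupCohomology.map c (pairSubQuot c φ hW hW' hφ hφ') n := by
  rw [← groupCohomology.map_comp, ← groupCohomology.map_comp]
  exact map_congr'' rfl _ _ (fun _ => rfl) n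

/-! ### Dévissage -/

section Devissage

variable {X : Type*} (c : X → (G →* G)) (φ : ∀ x, Rep.res (c x) A ⟶ A) (S : Set (X → k))

/-- **Extension step**: `Hⁿ(G, W')` is scalar-filtered if `Hⁿ(G, W)` and `Hⁿ(G, W'/W)` are
(`W ≤ W'` stable). [cite: Harder1987, §2] -/
theorem scalarFiltered_sub_of_subQuot {W W' : Submodule k A} (hW : ∀ g, W ≤ W.comap (A.ρ g))
    (hW' : ∀ g, W' ≤ W'.comap (A.ρ g)) (hle : W ≤ W') (hφ : ∀ x, ∀ w ∈ W, (φ x).hom w ∈ W)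
    (hφ' : ∀ x, ∀ w ∈ W', (φ x).hom w ∈ W') (n : ℕ)
    (hsub : ScalarFiltered (pairSubEnd c φ W hW hφ n) S ⊤)
    (hquot : ScalarFiltered
      (fun x => (groupCohomology.map (c x) (pairSubQuot (c x) (φ x) hW hW' (hφ x) (hφ' x)) n).hom) S ⊤) :
    ScalarFiltered (pairSubEnd c φ W' hW' hφ' n) S ⊤ := by
  have hX := subQuotComplex_shortExact A hW hW' hle
  have hexact : LinearMap.range ((groupCohomology.functor k G n).map (subInclusion hW hW' hle)).hom =
      LinearMap.ker ((groupCohomology.functor k G n).map (subMkQ A hW hW')).hom :=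
    (groupCohomology.mapShortComplex₂_exact hX n).moduleCat_range_eq_ker
  refine ScalarFiltered.of_exact (T' := pairSubEnd c φ W hW hφ n) (T := pairSubEnd c φ W' hW' hφ' n)
    (T'' := fun x => (groupCohomology.map (c x) (pairSubQuot (c x) (φ x) hW hW' (hφ x) (hφ' x)) n).hom)
    ((groupCohomology.functor k G n).map (subInclusion hW hW' hle)).hom
    ((groupCohomology.functor k G n).map (subMkQ A hW hW')).hom
    (fun x v => ?_) (fun x v => ?_) hexact hsub hquot
  · have h := map_pairSub_comp_inclusion (c x) (φ x) hW hW' hle (hφ x) (hφ' x) n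
    have := congrArg (fun ψ => ψ.hom v) h
    simp only [ModuleCat.hom_comp, LinearMap.comp_apply] at this
    rw [functor_map_eq]
    exact this
  · have h := map_pairSub_comp_mkQ (c x) (φ x) hW hW' (hφ x) (hφ' x) n
    have := congrArg (fun ψ => ψ.hom v) h
    simp only [ModuleCat.hom_comp, LinearMap.comp_apply] at this
    rw [functor_map_eq]
    exact this

/-- **`Hⁿ(G, 0)` is scalar-filtered** (it is `0`). [folklore] -/
theorem scalarFiltered_sub_bot (hφ : ∀ x, ∀ w ∈ (⊥ : Submodule k A), (φ x).hom w ∈ (⊥ : Submodule k A))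
    (n : ℕ) : ScalarFiltered (pairSubEnd c φ ⊥ (fun _ => bot_le) hφ n) S ⊤ := by
  haveI : Subsingleton (subRep A (⊥ : Submodule k A) (fun _ => bot_le)) :=
    ⟨fun a b => Subtype.ext ((Submodule.mem_bot k).1 a.2 |>.trans ((Submodule.mem_bot k).1 b.2).symm)⟩
  have hA : IsZero (subRep A (⊥ : Submodule k A) (fun _ => bot_le)) :=
    (IsZero.iff_id_eq_zero _).2 (Rep.hom_ext (Representation.IntertwiningMap.ext (LinearMap.ext fun a =>
      Subsingleton.elim _ _)))
  have hz : IsZero (groupCohomology (subRep A (⊥ : Submodule k A) (fun _ => bot_le)) n) :=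
    (groupCohomology.functor k G n).map_isZero hA
  haveI := ModuleCat.subsingleton_of_isZero hz
  rw [show (⊤ : Submodule k (groupCohomology (subRep A (⊥ : Submodule k A) (fun _ => bot_le)) n)) = ⊥
    from Subsingleton.elim _ _]
  exact ScalarFiltered.bot

/-! ### From `W = ⊤` to `A` -/

omit S in
/-- `Hⁿ(c, φ|_W) ≫ Hⁿ(W ↪ A) = Hⁿ(W ↪ A) ≫ Hⁿ(c, φ)`. [folklore] -/
theorem map_pairSub_comp_subtype (c : G →* G) (φ : Rep.res c A ⟶ A) (W : Submodule k A)
    (hW : ∀ g, W ≤ W.comap (A.ρ g)) (hφ : ∀ w ∈ W, φ.hom w ∈ W) (n : ℕ) :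
    groupCohomology.map c (pairSub c φ W hW hφ) n ≫ groupCohomology.map (MonoidHom.id G) (Rep.subtype A W hW) n =
      groupCohomology.map (MonoidHom.id G) (Rep.subtype A W hW) n ≫ groupCohomology.map c φ n := by
  rw [← groupCohomology.map_comp, ← groupCohomology.map_comp]
  exact map_congr'' rfl _ _ (fun _ => rfl) n

/-- The inverse `A ⟶ ⊤` of the inclusion of the top subrepresentation. [folklore] -/
def toSubTop : A ⟶ subRep A ⊤ (fun _ => le_top) :=
  Rep.ofHom (LinearMap.intertwiningMap_of_isIntertwiningMap _ _
    (LinearMap.codRestrict ⊤ LinearMap.id fun _ => trivial) fun _ _ => rfl)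

/-- `A ⟶ ⊤ ⟶ A` is the identity. [folklore] -/
theorem toSubTop_comp_subtype : toSubTop (A := A) ≫ Rep.subtype A ⊤ (fun _ => le_top) = 𝟙 A :=
  Rep.hom_ext (Representation.IntertwiningMap.ext (LinearMap.ext fun _ => rfl))

/-- **From the top of the filtration to `A`**: if `Hⁿ(G, ⊤)` is scalar-filtered then so is
`Hⁿ(G, A)`. [folklore] -/
theorem scalarFiltered_of_sub_top (hφ : ∀ x, ∀ w ∈ (⊤ : Submodule k A), (φ x).hom w ∈ (⊤ : Submodule k A))
    (n : ℕ) (h : ScalarFiltered (pairSubEnd c φ ⊤ (fun _ => le_top) hφ n) S ⊤) :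
    ScalarFiltered (fun x => (groupCohomology.map (c x) (φ x) n).hom) S ⊤ := by
  refine ScalarFiltered.of_surjective (T := pairSubEnd c φ ⊤ (fun _ => le_top) hφ n)
    ((groupCohomology.functor k G n).map (Rep.subtype A ⊤ fun _ => le_top)).hom ?_ (fun x v => ?_) h
  · intro a
    refine ⟨((groupCohomology.functor k G n).map (toSubTop (A := A))).hom a, ?_⟩
    change ((groupCohomology.functor k G n).map toSubTop ≫
      (groupCohomology.functor k G n).map (Rep.subtype A ⊤ fun _ => le_top)).hom a = a
    rw [← CategoryTheory.Functor.map_comp, toSubTop_comp_subtype, CategoryTheory.Functor.map_id]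
    rfl
  · have h := map_pairSub_comp_subtype (c x) (φ x) ⊤ (fun _ => le_top) (hφ x) n
    have := congrArg (fun ψ => ψ.hom v) h
    simp only [ModuleCat.hom_comp, LinearMap.comp_apply] at this
    rw [functor_map_eq]
    exact this

/-! ### The one-dimensional extension step -/

section Step

variable {W : Submodule k A} (hW : ∀ g, W ≤ W.comap (A.ρ g)) (hφ : ∀ x, ∀ w ∈ W, (φ x).hom w ∈ W)
  (v : A) (hvG : ∀ g, A.ρ g v - v ∈ W) (χ : X → k) (hvφ : ∀ x, (φ x).hom v - χ x • v ∈ W)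

include hW hvG in
omit S in
/-- `W + k v` is `G`-stable when `v` is `G`-invariant modulo the stable `W`. [folklore] -/
theorem sup_span_stable (g : G) : W ⊔ k ∙ v ≤ (W ⊔ k ∙ v).comap (A.ρ g) := by
  intro w' hw'
  obtain ⟨w, hw, u, hu, rfl⟩ := Submodule.mem_sup.1 hw'
  obtain ⟨a, rfl⟩ := Submodule.mem_span_singleton.1 hu
  rw [Submodule.mem_comap, map_add, map_smul,
    show A.ρ g w + a • A.ρ g v = (A.ρ g w + a • (A.ρ g v - v)) + a • v by rw [smul_sub]; abel]
  exact Submodule.add_mem_sup (W.add_mem (hW g hw) (W.smul_mem a (hvG g)))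
    (Submodule.smul_mem _ a (Submodule.mem_span_singleton_self v))

include hφ hvφ in
omit S in
/-- `W + k v` is `φ`-stable when `v` is a `φ`-eigenvector modulo the stable `W`. [folklore] -/
theorem sup_span_stableφ (x : X) : ∀ w' ∈ W ⊔ k ∙ v, (φ x).hom w' ∈ W ⊔ k ∙ v := by
  intro w' hw'
  obtain ⟨w, hw, u, hu, rfl⟩ := Submodule.mem_sup.1 hw'
  obtain ⟨a, rfl⟩ := Submodule.mem_span_singleton.1 hu
  rw [map_add, map_smul,
    show (φ x).hom w + a • (φ x).hom v = ((φ x).hom w + a • ((φ x).hom v - χ x • v)) + (a * χ x) • v by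
      rw [smul_sub, mul_smul]; abel]
  exact Submodule.add_mem_sup (W.add_mem (hφ x w hw) (W.smul_mem a (hvφ x)))
    (Submodule.smul_mem _ _ (Submodule.mem_span_singleton_self v))

include hW hvG in
omit S in
/-- `G` acts trivially on `(W + kv)/W`. [folklore] -/
theorem rho_sub_mem_of_mem_sup_span (g : G) {w' : A} (hw' : w' ∈ W ⊔ k ∙ v) : A.ρ g w' - w' ∈ W := by
  obtain ⟨w, hw, u, hu, rfl⟩ := Submodule.mem_sup.1 hw'
  obtain ⟨a, rfl⟩ := Submodule.mem_span_singleton.1 hu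
  rw [map_add, map_smul, show A.ρ g w + a • A.ρ g v - (w + a • v) = (A.ρ g w - w) + a • (A.ρ g v - v) by
    rw [smul_sub]; abel]
  exact W.add_mem (W.sub_mem (hW g hw) hw) (W.smul_mem a (hvG g))

include hφ hvφ in
omit S in
/-- `φ x` acts by `χ x` on `(W + kv)/W`. [folklore] -/
theorem phi_sub_smul_mem_of_mem_sup_span (x : X) {w' : A} (hw' : w' ∈ W ⊔ k ∙ v) :
    (φ x).hom w' - χ x • w' ∈ W := by
  obtain ⟨w, hw, u, hu, rfl⟩ := Submodule.mem_sup.1 hw'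
  obtain ⟨a, rfl⟩ := Submodule.mem_span_singleton.1 hu
  rw [map_add, map_smul, show (φ x).hom w + a • (φ x).hom v - χ x • (w + a • v) =
    ((φ x).hom w - χ x • w) + a • ((φ x).hom v - χ x • v) by rw [smul_add, smul_sub, smul_comm]; abel]
  exact W.add_mem (W.sub_mem (hφ x w hw) (W.smul_mem _ hw)) (W.smul_mem a (hvφ x))

include hvG hvφ in
/-- **One-dimensional extension step.**  If `Hⁿ(G, W)` is scalar-filtered with characters `S`,
`v` is `G`-invariant and a `φ`-eigenvector with character `χ` modulo `W`, and the scaled pair maps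
`Hⁿ(c x, χ x)` on `Hⁿ(G, k)` are scalar-filtered with characters in `S`, then `Hⁿ(G, W + kv)` is
scalar-filtered with characters `S`. [cite: Harder1987, §2] -/
theorem scalarFiltered_sub_sup_span (n : ℕ) (hgood : ScalarFiltered (pairSubEnd c φ W hW hφ n) S ⊤)
    (htriv : ScalarFiltered (fun x => pairMapₛ (k := k) (G := G) (c x) (χ x) n) S ⊤) :
    ScalarFiltered (pairSubEnd c φ (W ⊔ k ∙ v) (sup_span_stable hW v hvG)
      (sup_span_stableφ c φ hφ v χ hvφ) n) S ⊤ := by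
  have hle : W ≤ W ⊔ k ∙ v := le_sup_left
  set hW' := sup_span_stable hW v hvG
  set hφ' := sup_span_stableφ c φ hφ v χ hvφ
  refine scalarFiltered_sub_of_subQuot c φ S hW hW' hle hφ hφ' n hgood ?_
  -- the quotient `Q = (W + kv)/W`, generated by the class `q₀` of `v`, trivial `G`-action, `φ x = χ x`
  set Q := subQuot A hW hW' with hQ
  have hvmem : v ∈ W ⊔ k ∙ v := Submodule.mem_sup_right (Submodule.mem_span_singleton_self v)
  set q₀ : Q := (subIn A W (W ⊔ k ∙ v)).mkQ ⟨v, hvmem⟩ with hq₀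
  have hgenQ : ∀ q : Q, ∃ a : k, q = a • q₀ := by
    intro q
    obtain ⟨w', rfl⟩ := Submodule.mkQ_surjective _ q
    obtain ⟨w, hw, u, hu, hw'⟩ := Submodule.mem_sup.1 w'.2
    obtain ⟨a, rfl⟩ := Submodule.mem_span_singleton.1 hu
    refine ⟨a, ?_⟩
    rw [hq₀, ← map_smul, ← sub_eq_zero, ← map_sub, Submodule.mkQ_apply, Submodule.Quotient.mk_eq_zero]
    change ((w' : A) - a • v) ∈ W
    rw [← hw', add_sub_cancel_right]
    exact hw
  have htrivQ : ∀ (g : G) (q : Q), Q.ρ g q = q := by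
    intro g q
    obtain ⟨w', rfl⟩ := Submodule.mkQ_surjective _ q
    rw [← sub_eq_zero]
    change (subIn A W (W ⊔ k ∙ v)).mkQ ((subRep A (W ⊔ k ∙ v) hW').ρ g w') - (subIn A W (W ⊔ k ∙ v)).mkQ w' = 0
    rw [← map_sub, Submodule.mkQ_apply, Submodule.Quotient.mk_eq_zero]
    exact rho_sub_mem_of_mem_sup_span hW v hvG g w'.2
  have hφQ : ∀ (x : X) (q : Q), (pairSubQuot (c x) (φ x) hW hW' (hφ x) (hφ' x)).hom q = χ x • q := by
    intro x q
    obtain ⟨w', rfl⟩ := Submodule.mkQ_surjective _ q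
    rw [pairSubQuot_hom_apply_mk, ← sub_eq_zero, ← map_smul, ← map_sub, Submodule.mkQ_apply,
      Submodule.Quotient.mk_eq_zero]
    exact phi_sub_smul_mem_of_mem_sup_span c φ hφ v χ hvφ x w'.2
  by_cases hq0 : q₀ = 0
  · -- `Q = 0`
    haveI : Subsingleton Q := ⟨fun a b => by
      obtain ⟨a', rfl⟩ := hgenQ a
      obtain ⟨b', rfl⟩ := hgenQ b
      rw [hq0, smul_zero, smul_zero]⟩
    have hQ0 : IsZero Q := (IsZero.iff_id_eq_zero _).2
      (Rep.hom_ext (Representation.IntertwiningMap.ext (LinearMap.ext fun a => Subsingleton.elim _ _)))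
    have hz : IsZero (groupCohomology Q n) := (groupCohomology.functor k G n).map_isZero hQ0
    haveI := ModuleCat.subsingleton_of_isZero hz
    rw [show (⊤ : Submodule k (groupCohomology Q n)) = ⊥ from Subsingleton.elim _ _]
    exact ScalarFiltered.bot
  · -- `Q ≅ k` with `φ x ↦ χ x`
    -- the equivariant maps `e' : k → Q`, `a ↦ a q₀` and its inverse `e`
    set e'ₗ : k →ₗ[k] Q := LinearMap.toSpanSingleton k Q q₀ with he'
    have hinj' : Function.Injective e'ₗ := LinearMap.ker_eq_bot.1 (LinearMap.ker_toSpanSingleton k hq0)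
    have hsurj' : Function.Surjective e'ₗ := fun q => by
      obtain ⟨a, rfl⟩ := hgenQ q
      exact ⟨a, LinearMap.toSpanSingleton_apply _ _ _ _⟩
    set E : k ≃ₗ[k] Q := LinearEquiv.ofBijective e'ₗ ⟨hinj', hsurj'⟩ with hE
    set e : Q ⟶ trivRep k G := Rep.ofHom (LinearMap.intertwiningMap_of_isIntertwiningMap Q.ρ (trivRep k G).ρ
      E.symm.toLinearMap fun g q => by rw [htrivQ]; rfl) with he
    set e' : trivRep k G ⟶ Q := Rep.ofHom (LinearMap.intertwiningMap_of_isIntertwiningMap (trivRep k G).ρ Q.ρ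
      E.toLinearMap fun g a => by rw [htrivQ]; rfl) with he'def
    have hee' : e ≫ e' = 𝟙 Q :=
      Rep.hom_ext (Representation.IntertwiningMap.ext (LinearMap.ext fun q => E.apply_symm_apply q))
    have hinj : Function.Injective ((groupCohomology.functor k G n).map e).hom := by
      intro a b hab
      have := congrArg ((groupCohomology.functor k G n).map e').hom hab
      change ((groupCohomology.functor k G n).map e ≫ (groupCohomology.functor k G n).map e').hom a =
        ((groupCohomology.functor k G n).map e ≫ (groupCohomology.functor k G n).map e').hom b at this
      rwa [← CategoryTheory.Functor.map_comp, hee', CategoryTheory.Functor.map_id] at this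
    have hequiv : ∀ x y, ((groupCohomology.functor k G n).map e).hom
        ((groupCohomology.map (c x) (pairSubQuot (c x) (φ x) hW hW' (hφ x) (hφ' x)) n).hom y) =
        pairMapₛ (c x) (χ x) n (((groupCohomology.functor k G n).map e).hom y) := by
      intro x y
      have h : groupCohomology.map (c x) (pairSubQuot (c x) (φ x) hW hW' (hφ x) (hφ' x)) n ≫
          groupCohomology.map (MonoidHom.id G) e n =
          groupCohomology.map (MonoidHom.id G) e n ≫ groupCohomology.map (c x) (pairScalar (c x) (χ x)) n := by
        rw [← groupCohomology.map_comp, ← groupCohomology.map_comp]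
        refine map_congr'' rfl _ _ (fun q => ?_) n
        change E.symm ((pairSubQuot (c x) (φ x) hW hW' (hφ x) (hφ' x)).hom q) = χ x * E.symm q
        rw [hφQ, map_smul, smul_eq_mul]
      have := congrArg (fun ψ => ψ.hom y) h
      simp only [ModuleCat.hom_comp, LinearMap.comp_apply] at this
      rw [functor_map_eq]
      exact this
    exact ScalarFiltered.of_injective (T' := fun x => pairMapₛ (c x) (χ x) n)
      ((groupCohomology.functor k G n).map e).hom hinj hequiv htriv

end Step

/-! ### Changing the submodule -/

omit S in
/-- `pairSubEnd` only depends on the submodule. [folklore] -/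
theorem scalarFiltered_pairSubEnd_congr {W₁ W₂ : Submodule k A} (h : W₁ = W₂)
    {hW₁ : ∀ g, W₁ ≤ W₁.comap (A.ρ g)} {hφ₁ : ∀ x, ∀ w ∈ W₁, (φ x).hom w ∈ W₁}
    (hW₂ : ∀ g, W₂ ≤ W₂.comap (A.ρ g)) (hφ₂ : ∀ x, ∀ w ∈ W₂, (φ x).hom w ∈ W₂) {S : Set (X → k)} {n : ℕ}
    (h₁ : ScalarFiltered (pairSubEnd c φ W₁ hW₁ hφ₁ n) S ⊤) : ScalarFiltered (pairSubEnd c φ W₂ hW₂ hφ₂ n) S ⊤ := by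
  subst h
  exact h₁

/-! ### Stable subspaces of a triangularisable ambient representation -/

/-- Intersecting with a stable subspace keeps a one-step extension a one-step extension:
`V' ∩ (U + k w₀) = (V' ∩ U) + k v` for some `v`. [folklore] -/
theorem exists_inf_sup_span_eq {M : Type*} [AddCommGroup M] [Module k M] (V' U : Submodule k M) (w₀ : M) :
    ∃ v ∈ V' ⊓ (U ⊔ k ∙ w₀), V' ⊓ (U ⊔ k ∙ w₀) = (V' ⊓ U) ⊔ k ∙ v := by
  by_cases h : V' ⊓ (U ⊔ k ∙ w₀) ≤ V' ⊓ U
  · refine ⟨0, Submodule.zero_mem _, le_antisymm (h.trans le_sup_left) (sup_le (inf_le_inf_left _ le_sup_left) ?_)⟩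
    rw [Submodule.span_singleton_le_iff_mem]
    exact Submodule.zero_mem _
  · obtain ⟨v, hvW', hvW⟩ := Set.not_subset.1 h
    refine ⟨v, hvW', le_antisymm ?_ (sup_le (inf_le_inf_left _ le_sup_left)
      ((Submodule.span_singleton_le_iff_mem _ _).2 hvW'))⟩
    intro w' hw'
    obtain ⟨u, hu, z, hz, hvz⟩ := Submodule.mem_sup.1 hvW'.2
    obtain ⟨b, rfl⟩ := Submodule.mem_span_singleton.1 hz
    have hb : b ≠ 0 := by
      rintro rfl
      rw [zero_smul, add_zero] at hvz
      exact hvW ⟨hvW'.1, hvz ▸ hu⟩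
    obtain ⟨u', hu', z', hz', hw'z⟩ := Submodule.mem_sup.1 hw'.2
    obtain ⟨b', rfl⟩ := Submodule.mem_span_singleton.1 hz'
    have hdiff : w' - (b' / b) • v ∈ V' ⊓ U := by
      refine ⟨V'.sub_mem hw'.1 (V'.smul_mem _ hvW'.1), ?_⟩
      rw [← hw'z, ← hvz, smul_add, smul_smul, div_mul_cancel₀ _ hb, add_sub_add_right_eq_sub]
      exact U.sub_mem hu' (U.smul_mem _ hu)
    rw [show w' = (w' - (b' / b) • v) + (b' / b) • v by abel]
    exact Submodule.add_mem_sup hdiff (Submodule.smul_mem _ _ (Submodule.mem_span_singleton_self v))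

section Ambient

variable {I : Type*} [Fintype I] (w : I → A) (rank : I → ℕ)

/-- The span of the basis vectors of rank `< m`. [folklore] -/
def lowerSpan (m : ℕ) : Submodule k A := Submodule.span k (w '' {i | rank i < m})

omit [Fintype I] in
/-- `lowerSpan` is monotone. [folklore] -/
theorem lowerSpan_mono {m m' : ℕ} (h : m ≤ m') : lowerSpan w rank m ≤ lowerSpan w rank m' :=
  Submodule.span_mono (Set.image_mono fun _ hi => lt_of_lt_of_le hi h)

omit [Fintype I] in
/-- `w i ∈ lowerSpan (rank i + 1)`. [folklore] -/
theorem mem_lowerSpan_succ (i : I) : w i ∈ lowerSpan w rank (rank i + 1) :=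
  Submodule.subset_span ⟨i, Nat.lt_succ_self _, rfl⟩

omit [Fintype I] in
/-- One more rank, occupied by `i`: `lowerSpan (m+1) = lowerSpan m + k w_i`. [folklore] -/
theorem lowerSpan_succ_of_rank_eq (hrank : Function.Injective rank) {i : I} {m : ℕ} (hi : rank i = m) :
    lowerSpan w rank (m + 1) = lowerSpan w rank m ⊔ k ∙ w i := by
  have hset : {j | rank j < m + 1} = {j | rank j < m} ∪ {i} := by
    ext j
    simp only [Set.mem_setOf_eq, Set.mem_union, Set.mem_singleton_iff, Nat.lt_succ_iff]
    constructor
    · intro hj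
      rcases hj.lt_or_eq with hj | hj
      · exact Or.inl hj
      · exact Or.inr (hrank (hj.trans hi.symm))
    · rintro (hj | rfl)
      · exact hj.le
      · exact hi.le
  rw [lowerSpan, hset, Set.image_union, Set.image_singleton, Submodule.span_union]
  rfl

omit [Fintype I] in
/-- One more rank, unoccupied: `lowerSpan (m+1) = lowerSpan m`. [folklore] -/
theorem lowerSpan_succ_of_forall_ne {m : ℕ} (h : ∀ i, rank i ≠ m) :
    lowerSpan w rank (m + 1) = lowerSpan w rank m := by
  have hset : {j | rank j < m + 1} = {j | rank j < m} := by
    ext j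
    simp only [Set.mem_setOf_eq, Nat.lt_succ_iff]
    exact ⟨fun hj => lt_of_le_of_ne hj (h j), le_of_lt⟩
  rw [lowerSpan, hset]
  rfl

/-- Every basis vector lies in `lowerSpan M` for `M = max rank + 1`. [folklore] -/
theorem range_subset_lowerSpan_top :
    Set.range w ⊆ lowerSpan w rank (Finset.univ.sup rank + 1) := by
  rintro _ ⟨i, rfl⟩
  exact lowerSpan_mono w rank (Nat.succ_le_succ (Finset.le_sup (Finset.mem_univ i))) (mem_lowerSpan_succ w rank i)

variable (hwG : ∀ g i, A.ρ g (w i) - w i ∈ lowerSpan w rank (rank i))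

include hwG in
omit [Fintype I] in
/-- The flag `lowerSpan` is `G`-stable when `G` acts unitriangularly on the `w_i`. [folklore] -/
theorem lowerSpan_stable (m : ℕ) (g : G) : lowerSpan w rank m ≤ (lowerSpan w rank m).comap (A.ρ g) := by
  rw [lowerSpan, Submodule.span_le]
  rintro _ ⟨j, hj, rfl⟩
  rw [SetLike.mem_coe, Submodule.mem_comap, ← sub_add_cancel (A.ρ g (w j)) (w j)]
  exact Submodule.add_mem _ (lowerSpan_mono w rank hj.le (hwG g j)) (Submodule.subset_span ⟨j, hj, rfl⟩)

variable (χ : I → X → k) (hwφ : ∀ x i, (φ x).hom (w i) - χ i x • w i ∈ lowerSpan w rank (rank i))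

include hwφ in
omit [Fintype I] in
/-- The flag `lowerSpan` is `φ`-stable when the `w_i` are `φ`-eigenvectors modulo lower terms. [folklore] -/
theorem lowerSpan_stableφ (m : ℕ) (x : X) : ∀ v ∈ lowerSpan w rank m, (φ x).hom v ∈ lowerSpan w rank m := by
  intro v hv
  have : lowerSpan w rank m ≤ (lowerSpan w rank m).comap (φ x).hom.toLinearMap := by
    rw [lowerSpan, Submodule.span_le]
    rintro _ ⟨j, hj, rfl⟩
    rw [SetLike.mem_coe, Submodule.mem_comap]
    change (φ x).hom (w j) ∈ Submodule.span k (w '' {i | rank i < m})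
    rw [← sub_add_cancel ((φ x).hom (w j)) (χ j x • w j)]
    exact Submodule.add_mem _ (lowerSpan_mono w rank hj.le (hwφ x j))
      (Submodule.smul_mem _ _ (Submodule.subset_span ⟨j, hj, rfl⟩))
  exact this hv

variable (V' : Submodule k A) (hV'G : ∀ g, V' ≤ V'.comap (A.ρ g)) (hV'φ : ∀ x, ∀ v ∈ V', (φ x).hom v ∈ V')

include hwG hV'G in
omit [Fintype I] in
/-- `V' ∩ lowerSpan m` is `G`-stable. [folklore] -/
theorem inf_lowerSpan_stable (m : ℕ) (g : G) :
    V' ⊓ lowerSpan w rank m ≤ (V' ⊓ lowerSpan w rank m).comap (A.ρ g) := fun _ hv =>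
  ⟨hV'G g hv.1, lowerSpan_stable w rank hwG m g hv.2⟩

include hwφ hV'φ in
omit [Fintype I] in
/-- `V' ∩ lowerSpan m` is `φ`-stable. [folklore] -/
theorem inf_lowerSpan_stableφ (m : ℕ) (x : X) :
    ∀ v ∈ V' ⊓ lowerSpan w rank m, (φ x).hom v ∈ V' ⊓ lowerSpan w rank m := fun v hv =>
  ⟨hV'φ x v hv.1, lowerSpan_stableφ c φ w rank χ hwφ m x v hv.2⟩

include hwG hwφ in
/-- **Stable subspaces of a triangularisable representation have scalar-filtered cohomology.**
Let `w : I → A` be vectors with an injective `rank`, on which `G` acts unitriangularly and the pair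
maps `φ x` act diagonally with characters `χ i` modulo lower rank, and such that the scaled pair maps
`Hⁿ(c x, χ i x)` on `Hⁿ(G, k)` are scalar-filtered with characters in `S`.  Then for every `G`- and
`φ`-stable subspace `V'` of the span of the `w i`, `Hⁿ(G, V')` is scalar-filtered with characters
`S` (filter `V'` by `V' ∩ lowerSpan m`; the steps have dimension `≤ 1`). [cite: Harder1987, §2] -/
theorem scalarFiltered_sub_of_ambient (hrank : Function.Injective rank)
    (htriv : ∀ i n, ScalarFiltered (fun x => pairMapₛ (k := k) (G := G) (c x) (χ i x) n) S ⊤)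
    (hV'le : V' ≤ Submodule.span k (Set.range w)) (n : ℕ) :
    ScalarFiltered (pairSubEnd c φ V' hV'G hV'φ n) S ⊤ := by
  -- induction over the flag `V' ∩ lowerSpan m`
  have key : ∀ m : ℕ, ScalarFiltered (pairSubEnd c φ (V' ⊓ lowerSpan w rank m)
      (inf_lowerSpan_stable w rank hwG V' hV'G m) (inf_lowerSpan_stableφ c φ w rank χ hwφ V' hV'φ m) n) S ⊤ := by
    intro m
    induction m with
    | zero =>
      have h0 : (⊥ : Submodule k A) = V' ⊓ lowerSpan w rank 0 := by
        refine (eq_bot_iff.2 ?_).symm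
        rintro v ⟨-, hv⟩
        have : lowerSpan w rank 0 = ⊥ := by
          rw [lowerSpan, Submodule.span_eq_bot]
          rintro _ ⟨j, hj, rfl⟩
          exact absurd hj (Nat.not_lt_zero _)
        rw [this] at hv
        exact hv
      exact scalarFiltered_pairSubEnd_congr c φ h0 _ _
        (scalarFiltered_sub_bot c φ S (fun x w hw => by rw [(Submodule.mem_bot k).1 hw, map_zero]; exact Submodule.zero_mem _) n)
    | succ m ih =>
      by_cases hex : ∃ i, rank i = m
      · obtain ⟨i, hi⟩ := hex
        set W := V' ⊓ lowerSpan w rank m with hWdef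
        have hU : lowerSpan w rank (m + 1) = lowerSpan w rank m ⊔ k ∙ w i :=
          lowerSpan_succ_of_rank_eq w rank hrank hi
        obtain ⟨v, hvW', hW'⟩ := exists_inf_sup_span_eq V' (lowerSpan w rank m) (w i)
        -- `v = u + b w_i`
        obtain ⟨u, hu, z, hz, hvz⟩ := Submodule.mem_sup.1 hvW'.2
        obtain ⟨b, rfl⟩ := Submodule.mem_span_singleton.1 hz
        have hvG : ∀ g, A.ρ g v - v ∈ W := by
          intro g
          refine ⟨V'.sub_mem (hV'G g hvW'.1) hvW'.1, ?_⟩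
          rw [← hvz, map_add, map_smul,
            show A.ρ g u + b • A.ρ g (w i) - (u + b • w i) = (A.ρ g u - u) + b • (A.ρ g (w i) - w i) by
              rw [smul_sub]; abel]
          exact Submodule.add_mem _ (Submodule.sub_mem _ (lowerSpan_stable w rank hwG m g hu) hu)
            (Submodule.smul_mem _ _ (hi ▸ hwG g i))
        have hvφ : ∀ x, (φ x).hom v - χ i x • v ∈ W := by
          intro x
          refine ⟨V'.sub_mem (hV'φ x v hvW'.1) (V'.smul_mem _ hvW'.1), ?_⟩
          rw [← hvz, map_add, map_smul,
            show (φ x).hom u + b • (φ x).hom (w i) - χ i x • (u + b • w i) =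
              ((φ x).hom u - χ i x • u) + b • ((φ x).hom (w i) - χ i x • w i) by
              rw [smul_add, smul_sub, smul_comm]; abel]
          exact Submodule.add_mem _ (Submodule.sub_mem _ (lowerSpan_stableφ c φ w rank χ hwφ m x u hu)
            (Submodule.smul_mem _ _ hu)) (Submodule.smul_mem _ _ (hi ▸ hwφ x i))
        have step := scalarFiltered_sub_sup_span c φ S (inf_lowerSpan_stable w rank hwG V' hV'G m)
          (inf_lowerSpan_stableφ c φ w rank χ hwφ V' hV'φ m) v hvG (χ i) hvφ n ih (htriv i n)
        have heq : (V' ⊓ lowerSpan w rank m) ⊔ k ∙ v = V' ⊓ lowerSpan w rank (m + 1) := by rw [hU, hW']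
        exact scalarFiltered_pairSubEnd_congr c φ heq _ _ step
      · push Not at hex
        have heq : V' ⊓ lowerSpan w rank m = V' ⊓ lowerSpan w rank (m + 1) := by
          rw [lowerSpan_succ_of_forall_ne w rank hex]
        exact scalarFiltered_pairSubEnd_congr c φ heq _ _ ih
  have htop : V' ⊓ lowerSpan w rank (Finset.univ.sup rank + 1) = V' :=
    inf_eq_left.2 (hV'le.trans (Submodule.span_le.2 (range_subset_lowerSpan_top w rank)))
  exact scalarFiltered_pairSubEnd_congr c φ htop _ _ (key _)

end Ambient

/-! ### Transport along an injective equivariant map -/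

section Transport

variable {B : Rep.{u} k G} (ψ : ∀ x, Rep.res (c x) B ⟶ B) (j : B ⟶ A) (hj : Function.Injective j.hom)
  (hjψ : ∀ x b, j.hom ((ψ x).hom b) = (φ x).hom (j.hom b))

/-- The image of an equivariant map is `G`-stable. [folklore] -/
theorem range_stable (g : G) :
    LinearMap.range j.hom.toLinearMap ≤ (LinearMap.range j.hom.toLinearMap).comap (A.ρ g) := by
  rintro _ ⟨b, rfl⟩
  exact ⟨B.ρ g b, Rep.hom_comm_apply j g b⟩

include hjψ in
/-- The image of a map compatible with the pair maps is stable under them. [folklore] -/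
theorem range_stableφ (x : X) :
    ∀ v ∈ LinearMap.range j.hom.toLinearMap, (φ x).hom v ∈ LinearMap.range j.hom.toLinearMap := by
  rintro _ ⟨b, rfl⟩
  exact ⟨(ψ x).hom b, hjψ x b⟩

/-- The corestriction `B ⟶ j(B)` of an equivariant map. [folklore] -/
def corestrict : B ⟶ subRep A (LinearMap.range j.hom.toLinearMap) (range_stable j) :=
  Rep.ofHom (LinearMap.intertwiningMap_of_isIntertwiningMap _ _
    (LinearMap.codRestrict (LinearMap.range j.hom.toLinearMap) j.hom.toLinearMap fun b => ⟨b, rfl⟩)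
    fun g b => Subtype.ext (Rep.hom_comm_apply j g b))

/-- Unfolding `corestrict`. [folklore] -/
@[simp]
theorem corestrict_hom_apply_coe (b : B) : ((corestrict j).hom b : A) = j.hom b := rfl

include hj in
/-- The corestriction of an injective map is bijective. [folklore] -/
theorem corestrict_bijective : Function.Bijective (corestrict j).hom := by
  constructor
  · intro a b hab
    exact hj (congrArg (fun v : LinearMap.range j.hom.toLinearMap => (v : A)) hab)
  · rintro ⟨_, b, rfl⟩
    exact ⟨b, rfl⟩

/-- The inverse `j(B) ⟶ B` of the corestriction of an injective equivariant map. [folklore] -/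
def corestrictInv : subRep A (LinearMap.range j.hom.toLinearMap) (range_stable j) ⟶ B :=
  Rep.ofHom (LinearMap.intertwiningMap_of_isIntertwiningMap _ _
    (LinearEquiv.ofBijective (corestrict j).hom.toLinearMap (corestrict_bijective j hj)).symm.toLinearMap
    fun g v => by
      set E := LinearEquiv.ofBijective (corestrict j).hom.toLinearMap (corestrict_bijective j hj) with hE
      have h1 : ∀ w, (corestrict j).hom (E.symm w) = w := fun w => E.apply_symm_apply w
      apply (corestrict_bijective j hj).1
      change (corestrict j).hom (E.symm _) = (corestrict j).hom (B.ρ g (E.symm v))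
      rw [Rep.hom_comm_apply (corestrict j) g, h1, h1])

/-- `j(B) ⟶ B ⟶ j(B)`: `corestrict (corestrictInv v) = v`. [folklore] -/
theorem corestrict_corestrictInv_apply (v : subRep A (LinearMap.range j.hom.toLinearMap) (range_stable j)) :
    (corestrict j).hom ((corestrictInv j hj).hom v) = v :=
  (LinearEquiv.ofBijective (corestrict j).hom.toLinearMap (corestrict_bijective j hj)).apply_symm_apply v

/-- `B ⟶ j(B) ⟶ B` is the identity. [folklore] -/
theorem corestrict_comp_corestrictInv : corestrict j ≫ corestrictInv j hj = 𝟙 B := by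
  refine Rep.hom_ext (Representation.IntertwiningMap.ext (LinearMap.ext fun b => ?_))
  apply (corestrict_bijective j hj).1
  change (corestrict j).hom ((corestrictInv j hj).hom ((corestrict j).hom b)) = (corestrict j).hom b
  rw [corestrict_corestrictInv_apply]

include hjψ in
/-- The corestriction intertwines the pair maps. [folklore] -/
theorem map_comp_map_corestrict (x : X) (n : ℕ) :
    groupCohomology.map (c x) (ψ x) n ≫ groupCohomology.map (MonoidHom.id G) (corestrict j) n =
      groupCohomology.map (MonoidHom.id G) (corestrict j) n ≫
        groupCohomology.map (c x) (pairSub (c x) (φ x) _ (range_stable j) (range_stableφ c φ ψ j hjψ x)) n := by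
  rw [← groupCohomology.map_comp, ← groupCohomology.map_comp]
  refine map_congr'' rfl _ _ (fun b => Subtype.ext ?_) n
  rw [Rep.hom_comp, Rep.hom_comp, Representation.IntertwiningMap.comp_apply,
    Representation.IntertwiningMap.comp_apply, Rep.resMap_hom_apply, Rep.resMap_hom_apply,
    pairSub_hom_apply_coe, corestrict_hom_apply_coe, corestrict_hom_apply_coe]
  exact hjψ x b

include hj hjψ in
/-- **Transport**: if `j : B ↪ A` is injective, equivariant and compatible with the pair maps, and
`Hⁿ(G, j(B))` is scalar-filtered, then so is `Hⁿ(G, B)`. [folklore] -/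
theorem scalarFiltered_of_injective_hom (n : ℕ)
    (h : ScalarFiltered (pairSubEnd c φ (LinearMap.range j.hom.toLinearMap) (range_stable j)
      (range_stableφ c φ ψ j hjψ) n) S ⊤) :
    ScalarFiltered (fun x => (groupCohomology.map (c x) (ψ x) n).hom) S ⊤ := by
  have hinj : Function.Injective ((groupCohomology.functor k G n).map (corestrict j)).hom := by
    intro a b hab
    have := congrArg ((groupCohomology.functor k G n).map (corestrictInv j hj)).hom hab
    change ((groupCohomology.functor k G n).map (corestrict j) ≫
        (groupCohomology.functor k G n).map (corestrictInv j hj)).hom a =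
      ((groupCohomology.functor k G n).map (corestrict j) ≫
        (groupCohomology.functor k G n).map (corestrictInv j hj)).hom b at this
    rwa [← CategoryTheory.Functor.map_comp, corestrict_comp_corestrictInv, CategoryTheory.Functor.map_id] at this
  refine ScalarFiltered.of_injective
    (T' := pairSubEnd c φ (LinearMap.range j.hom.toLinearMap) (range_stable j) (range_stableφ c φ ψ j hjψ) n)
    ((groupCohomology.functor k G n).map (corestrict j)).hom hinj (fun x y => ?_) h
  have := congrArg (fun φ' => φ'.hom y) (map_comp_map_corestrict c φ ψ j hjψ x n)
  simp only [ModuleCat.hom_comp, LinearMap.comp_apply] at this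
  rw [functor_map_eq]
  exact this

end Transport

end Devissage

end Literature.Algebra.Homology
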